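import Mathlib
import HarnessLib

/-!
# Convergence of the alternating direction method of multipliers (Boyd–Parikh–Chu–Peleato–Eckstein 2011, §3 and Appendix A)

Literature anchor (statements and proofs follow the source; nothing here is new mathematics):

* [BPCPE11] S. Boyd, N. Parikh, E. Chu, B. Peleato, J. Eckstein, *Distributed Optimization and
  Statistical Learning via the Alternating Direction Method of Multipliers*, Found. Trends Mach.
  Learn. **3** (1) (2011) 1–122, doi:10.1561/2200000016 (bib key `BoydEtAl2011`; text read from the
  author-hosted copy `admm_distr_stats.pdf`, `lit` key `paper:url-20b281840056`: §3.1 p. 13–15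
  (PDF pp. 16–18), §3.2 pp. 15–17 (PDF 18–20), §3.3 pp. 18–19 (PDF 21–22), Appendix A
  pp. 106–110 (PDF 109–113)).

THE PROBLEM AND THE METHOD [BPCPE11, §3.1 (3.1)–(3.4)]: `minimize f(x) + g(z) subject to
Ax + Bz = c`, augmented Lagrangian
`L_ρ(x, z, y) = f(x) + g(z) + yᵀ(Ax + Bz − c) + (ρ/2)‖Ax + Bz − c‖₂²`, and the iteration
`x^{k+1} := argmin_x L_ρ(x, z^k, y^k)` (3.2), `z^{k+1} := argmin_z L_ρ(x^{k+1}, z, y^k)` (3.3),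
`y^{k+1} := y^k + ρ(Ax^{k+1} + Bz^{k+1} − c)` (3.4), `ρ > 0`.

THE THEOREM [BPCPE11, §3.2.1, proved in Appendix A]: under Assumption 1 (`f`, `g` closed proper
convex) and Assumption 2 (the unaugmented Lagrangian `L_0` has a saddle point `(x⋆, z⋆, y⋆)`):
RESIDUAL CONVERGENCE `r^k = Ax^k + Bz^k − c → 0` and OBJECTIVE CONVERGENCE
`p^k = f(x^k) + g(z^k) → p⋆`; moreover `B(z^{k+1} − z^k) → 0`, so the dual residual
`s^{k+1} = ρAᵀB(z^{k+1} − z^k) → 0`.  The proof runs through the Lyapunov function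
`V^k = (1/ρ)‖y^k − y⋆‖₂² + ρ‖B(z^k − z⋆)‖₂²` and the three key inequalities
(A.1) `V^{k+1} ≤ V^k − ρ‖r^{k+1}‖₂² − ρ‖B(z^{k+1} − z^k)‖₂²`,
(A.2) `p^{k+1} − p⋆ ≤ −(y^{k+1})ᵀr^{k+1} − ρ(B(z^{k+1} − z^k))ᵀ(−r^{k+1} + B(z^{k+1} − z⋆))`,
(A.3) `p⋆ − p^{k+1} ≤ y⋆ᵀ r^{k+1}`.

## What is formalised (namespace `Literature.Analysis.Convex.ADMM`)

* `isMinOn_linearised` — the convex-analysis step used twice in the proof of (A.2)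
  [BPCPE11, App. A, "Proof of inequality (A.2)"; §3.3]: if `x⁺` minimises
  `φ(x) + wᵀ(Tx + v) + (ρ/2)‖Tx + v‖²` over a convex set on which `φ` is convex, then `x⁺`
  minimises the LINEARISED function `φ(x) + (w + ρ(Tx⁺ + v))ᵀ T x` over the same set (the book
  obtains this from `0 ∈ ∂φ(x⁺) + Tᵀ(w + ρ(Tx⁺ + v))`; here it is proved directly from convexity,
  without subdifferentials).
* `Problem` (the data `f, dom f, g, dom g, A, B, c`), `Problem.residual`, `Problem.objective`,
  `Problem.augLagrangian` (`L_ρ`; `L_0 = augLagrangian 0`), `Problem.IsConvex` (Assumption 1),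
  `Problem.IsSaddlePoint` (Assumption 2) with `IsSaddlePoint.residual_eq_zero` /
  `IsSaddlePoint.objective_le` (a saddle point is primal feasible and optimal, §3.2),
  `Problem.IsADMMSeq` (the iterates (3.2)–(3.4) as data: each `x^{k+1}`, `z^{k+1}` IS a minimiser),
  `Problem.lyapunov` (`V^k`).
* §3.1.1: `inner_add_norm_sq_eq_scaled` (`yᵀr + (ρ/2)‖r‖² = (ρ/2)‖r + (1/ρ)y‖² − (1/2ρ)‖y‖²`) and
  `IsADMMSeq.inv_smul_y_eq_sum` (`u^k = u^0 + Σ_{j=1}^k r^j`, `u = (1/ρ)y`).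
* §3.3 (3.10) and the first display of p. 18: `IsADMMSeq.z_isMinOn_linear` (`z^{k+1}` minimises
  `g(z) + (y^{k+1})ᵀBz`, i.e. `(z^{k+1}, y^{k+1})` is always dual feasible in the `z`-block) and
  `IsADMMSeq.x_isMinOn_linear` (`x^{k+1}` minimises `f(x) + (y^{k+1} − ρB(z^{k+1} − z^k))ᵀAx`).
* Appendix A: `IsADMMSeq.optimal_sub_objective_le` (A.3), `IsADMMSeq.objective_sub_optimal_le`
  (A.2), `IsADMMSeq.objective_sub_optimal_le'` ((3.11), the form with the dual residual),
  `IsADMMSeq.lyapunov_sub_succ_ge` (A.6), `IsADMMSeq.inner_residual_map_sub_nonpos` (the sign of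
  the cross term, last paragraph of App. A), `IsADMMSeq.lyapunov_succ_le` (A.1),
  `IsADMMSeq.lyapunov_antitone`, `IsADMMSeq.norm_y_sub_sq_le` / `IsADMMSeq.norm_map_sub_sq_le`
  ("`y^k` and `Bz^k` are bounded"), `IsADMMSeq.sum_range_le` / `IsADMMSeq.summable_sq`
  (`ρ Σ (‖r^{k+1}‖² + ‖B(z^{k+1} − z^k)‖²) ≤ V`), and the conclusions of §3.2.1:
  `IsADMMSeq.tendsto_residual` (`r^k → 0`), `IsADMMSeq.tendsto_map_sub` (`B(z^{k+1} − z^k) → 0`),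
  `IsADMMSeq.tendsto_dualResidual` (`s^k → 0` through any continuous linear `Aᵀ`),
  `IsADMMSeq.tendsto_objective` (`p^k → p⋆`).

Everything is proved; there are no named facts and no `sorry`.

## Conventions and deviations

* FUNCTIONS.  [BPCPE11, Assumption 1] take `f : ℝⁿ → ℝ ∪ {+∞}`, `g : ℝᵐ → ℝ ∪ {+∞}` closed proper
  convex.  Here `f : E₁ → ℝ`, `g : E₂ → ℝ` are real-valued and convex ON their effective domains
  `domf ⊆ E₁`, `domg ⊆ E₂` (convex sets; `Problem.IsConvex` = Mathlib `ConvexOn`), and the `x`- and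
  `z`-minimisations are over `domf`, `domg` — this is the same problem (an indicator function is a
  domain), and closedness is used in the source only to make the subproblems solvable, which here
  is part of the data: `IsADMMSeq` asserts that `x^{k+1}`, `z^{k+1}` ARE minimisers
  ("not necessarily unique", p. 16).
* SPACES.  `x`, `z` live in arbitrary real vector spaces `E₁`, `E₂`; `A : E₁ →ₗ[ℝ] F`,
  `B : E₂ →ₗ[ℝ] F` are linear maps into a real inner product space `F` (the book: matrices,
  `F = ℝᵖ`).  Transposes are written adjoint-free: `yᵀ(Ax)` is `⟪y, A x⟫`, and the dual residual
  `s^{k+1} = ρAᵀB(z^{k+1} − z^k)` enters (3.11) as `ρ⟪B(z^{k+1} − z^k), A(x^{k+1} − x⋆)⟫`;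
  `tendsto_dualResidual` pushes `B(z^{k+1} − z^k) → 0` through any continuous linear map
  (e.g. `ρAᵀ`).
* THE INDEX IN (A.1).  The printed proof of (A.1) uses "`z^k` minimizes `g(z) + y^{kT}Bz`", which
  is (3.10) for `k ≥ 1` but is not available for the arbitrary starting point `z^0`.  We prove
  (A.6) `V^k − V^{k+1} ≥ ρ‖r^{k+1} − B(z^{k+1} − z^k)‖² ≥ 0` for ALL `k` (so `V^k ≤ V^0`, and the
  boundedness statements hold as printed) and (A.1) for `k ≥ 1`, and sum (A.1) from `k = 1`
  (`ρ Σ_{k ≥ 1} (…) ≤ V^1 ≤ V^0`); the conclusions `r^k → 0`, `B(z^{k+1} − z^k) → 0`, `p^k → p⋆`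
  are exactly the source's.
* NOT HERE.  "Dual variable convergence `y^k → y⋆`" is listed in §3.2.1 but not proved in
  Appendix A, and is not formalised; neither are convergence of `x^k`, `z^k` (not claimed), the
  stopping criteria (3.12), over-relaxation, or any floating-point behaviour.  Related anchors in
  this directory: `KrasnoselskijIteration` (averaged nonexpansive iterations),
  `SplittingConicSolver` (the Douglas–Rachford/SCS map on the homogeneous self-dual embedding),
  `HomogeneousSelfDualEmbedding`, `MoreauConeDecomposition`, `ProximalMap`.
-/

open Filter Finset
open scoped RealInnerProductSpace Topology

noncomputable section

namespace Literature.Analysis.Convex.ADMM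

/-! ## An elementary real-number lemma -/

/-- If `0 ≤ a + t·b` for every `t ∈ (0, 1]`, where `b ≥ 0`, then `0 ≤ a` (let `t → 0⁺`).
[folklore] -/
private theorem nonneg_of_forall_small {a b : ℝ} (hb : 0 ≤ b)
    (h : ∀ t : ℝ, 0 < t → t ≤ 1 → 0 ≤ a + t * b) : 0 ≤ a := by
  rcases le_or_gt 0 a with ha | ha
  · exact ha
  exfalso
  have hb1 : 0 < b + 1 := by linarith
  set t : ℝ := min 1 (-a / (2 * (b + 1))) with ht_def
  have ht0 : 0 < t := lt_min one_pos (div_pos (by linarith) (by positivity))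
  have ht1 : t ≤ 1 := min_le_left _ _
  have ht2 : t ≤ -a / (2 * (b + 1)) := min_le_right _ _
  have key := h t ht0 ht1
  have h3 : t * (b + 1) ≤ -a / 2 := by
    calc t * (b + 1) ≤ -a / (2 * (b + 1)) * (b + 1) :=
          mul_le_mul_of_nonneg_right ht2 hb1.le
      _ = -a / 2 := by field_simp
  have h4 : t * b ≤ t * (b + 1) := by nlinarith
  linarith

/-! ## The first-order condition of a convex-plus-quadratic minimisation, in linearised form -/

section FirstOrder

variable {E F : Type*} [AddCommGroup E] [Module ℝ E] [NormedAddCommGroup F] [InnerProductSpace ℝ F]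

/-- **The convex-analysis step of the proof of (A.2).**  Let `φ` be convex on the convex set `S`,
`T` linear, `w, v` vectors and `ρ ≥ 0`.  If `x⁺ ∈ S` minimises
`φ(x) + ⟪w, Tx + v⟫ + (ρ/2)‖Tx + v‖²` over `S`, then `x⁺` minimises the linearised function
`φ(x) + ⟪w + ρ(Tx⁺ + v), Tx⟫` over `S`.  ([BPCPE11, App. A] derive this from the optimality
condition `0 ∈ ∂φ(x⁺) + Tᵀw + ρTᵀ(Tx⁺ + v)`, "the subdifferential of the sum of a
subdifferentiable function and a differentiable function … is the sum of the subdifferential and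
the gradient", and read it back as "`x^{k+1}` minimizes `f(x) + (y^{k+1} − ρB(z^{k+1} − z^k))ᵀAx`";
here: compare the values at `x⁺ + t(x − x⁺)`, `t ∈ (0,1]`, use convexity of `φ` and the exact
expansion of the quadratic, divide by `t` and let `t → 0⁺`.)
[cite: BoydEtAl2011, Appendix A, proof of (A.2)] -/
theorem isMinOn_linearised {S : Set E} {φ : E → ℝ} (hφ : ConvexOn ℝ S φ) (T : E →ₗ[ℝ] F)
    (w v : F) {ρ : ℝ} (hρ : 0 ≤ ρ) {x₁ : E} (hx₁ : x₁ ∈ S)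
    (hmin : IsMinOn (fun x => φ x + ⟪w, T x + v⟫ + ρ / 2 * ‖T x + v‖ ^ 2) S x₁) :
    IsMinOn (fun x => φ x + ⟪w + ρ • (T x₁ + v), T x⟫) S x₁ := by
  rw [isMinOn_iff] at hmin ⊢
  intro x hx
  set a : F := T x₁ + v with ha_def
  set d : F := T x - T x₁ with hd_def
  have key : ∀ t : ℝ, 0 < t → t ≤ 1 →
      0 ≤ (φ x - φ x₁ + ⟪w + ρ • a, d⟫) + t * (ρ / 2 * ‖d‖ ^ 2) := by
    intro t ht0 ht1
    have hxt : (1 - t) • x₁ + t • x ∈ S := hφ.1 hx₁ hx (by linarith) ht0.le (by ring)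
    have hle := hmin _ hxt
    have hconv : φ ((1 - t) • x₁ + t • x) ≤ (1 - t) • φ x₁ + t • φ x :=
      hφ.2 hx₁ hx (by linarith) ht0.le (by ring)
    simp only [smul_eq_mul] at hconv
    have hT : T ((1 - t) • x₁ + t • x) + v = a + t • d := by
      rw [ha_def, hd_def, map_add, map_smul, map_smul, smul_sub, sub_smul, one_smul]
      abel
    rw [hT] at hle
    have h1 : ⟪w, a + t • d⟫ = ⟪w, a⟫ + t * ⟪w, d⟫ := by
      rw [inner_add_right, real_inner_smul_right]
    have h2 : ‖a + t • d‖ ^ 2 = ‖a‖ ^ 2 + 2 * t * ⟪a, d⟫ + t ^ 2 * ‖d‖ ^ 2 := by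
      rw [norm_add_sq_real, real_inner_smul_right, norm_smul, mul_pow, Real.norm_eq_abs, sq_abs]
      ring
    have h3 : ⟪w + ρ • a, d⟫ = ⟪w, d⟫ + ρ * ⟪a, d⟫ := by
      rw [inner_add_left, real_inner_smul_left]
    rw [h1, h2] at hle
    rw [h3]
    -- `hle : φ x₁ + ⟪w, a⟫ + ρ/2‖a‖² ≤ φ xₜ + (⟪w, a⟫ + t⟪w, d⟫) + ρ/2 (‖a‖² + 2t⟪a, d⟫ + t²‖d‖²)`
    have hprod : 0 ≤ t * ((φ x - φ x₁ + (⟪w, d⟫ + ρ * ⟪a, d⟫)) + t * (ρ / 2 * ‖d‖ ^ 2)) := by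
      have e : t * ((φ x - φ x₁ + (⟪w, d⟫ + ρ * ⟪a, d⟫)) + t * (ρ / 2 * ‖d‖ ^ 2)) =
          (φ ((1 - t) • x₁ + t • x) + (⟪w, a⟫ + t * ⟪w, d⟫) +
              ρ / 2 * (‖a‖ ^ 2 + 2 * t * ⟪a, d⟫ + t ^ 2 * ‖d‖ ^ 2) -
            (φ x₁ + ⟪w, a⟫ + ρ / 2 * ‖a‖ ^ 2)) +
          ((1 - t) * φ x₁ + t * φ x - φ ((1 - t) • x₁ + t • x)) := by
        ring
      rw [e]
      exact add_nonneg (sub_nonneg.mpr hle) (sub_nonneg.mpr hconv)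
    refine le_of_mul_le_mul_left ?_ ht0
    rw [mul_zero]
    exact hprod
  have h0 : 0 ≤ φ x - φ x₁ + ⟪w + ρ • a, d⟫ :=
    nonneg_of_forall_small (by positivity) key
  rw [hd_def, inner_sub_right] at h0
  linarith

end FirstOrder

/-! ## The problem (3.1), the augmented Lagrangian, saddle points, ADMM iterates -/

variable {E₁ E₂ F : Type*} [AddCommGroup E₁] [Module ℝ E₁] [AddCommGroup E₂] [Module ℝ E₂]
  [NormedAddCommGroup F] [InnerProductSpace ℝ F]

variable (E₁ E₂ F) in
/-- The data of problem (3.1) of [BPCPE11, §3.1]: `minimize f(x) + g(z) subject to Ax + Bz = c`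
with `f` convex on its effective domain `domf ⊆ E₁` and `g` convex on `domg ⊆ E₂` (the book's
closed proper convex `f : ℝⁿ → ℝ ∪ {+∞}` restricted to `dom f`; see the module docstring),
`A`, `B` linear into the inner product space `F ∋ c`. [cite: BoydEtAl2011, §3.1 (3.1)] -/
structure Problem where
  /-- the first objective term `f` -/
  f : E₁ → ℝ
  /-- the effective domain of `f` (the `x`-minimisation runs over it) -/
  domf : Set E₁
  /-- the second objective term `g` -/
  g : E₂ → ℝ
  /-- the effective domain of `g` (the `z`-minimisation runs over it) -/
  domg : Set E₂
  /-- the linear map `A` -/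
  A : E₁ →ₗ[ℝ] F
  /-- the linear map `B` -/
  B : E₂ →ₗ[ℝ] F
  /-- the right-hand side `c` -/
  c : F

namespace Problem

variable (P : Problem E₁ E₂ F)

/-- The (primal) residual `r = Ax + Bz − c` [BPCPE11, §3.1.1; §3.3 "primal residual"].
[cite: BoydEtAl2011, §3.3] -/
def residual (x : E₁) (z : E₂) : F := P.A x + P.B z - P.c

/-- The objective value `p = f(x) + g(z)` [BPCPE11, §3.1; App. A `p^k = f(x^k) + g(z^k)`].
[cite: BoydEtAl2011, §3.1 (3.1)] -/
def objective (x : E₁) (z : E₂) : ℝ := P.f x + P.g z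

/-- The augmented Lagrangian
`L_ρ(x, z, y) = f(x) + g(z) + yᵀ(Ax + Bz − c) + (ρ/2)‖Ax + Bz − c‖₂²` [BPCPE11, §3.1];
`L_0 = augLagrangian 0` is the unaugmented Lagrangian. [cite: BoydEtAl2011, §3.1] -/
def augLagrangian (ρ : ℝ) (x : E₁) (z : E₂) (y : F) : ℝ :=
  P.objective x z + ⟪y, P.residual x z⟫ + ρ / 2 * ‖P.residual x z‖ ^ 2

/-- `L_0(x, z, y) = f(x) + g(z) + yᵀ(Ax + Bz − c)`. [cite: BoydEtAl2011, §3.1] -/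
theorem augLagrangian_zero (x : E₁) (z : E₂) (y : F) :
    P.augLagrangian 0 x z y = P.objective x z + ⟪y, P.residual x z⟫ := by
  simp [augLagrangian]

/-- ASSUMPTION 1 of [BPCPE11, §3.2] in the real-valued-on-a-domain form: `f` is convex on the
convex set `domf` and `g` is convex on the convex set `domg`. [cite: BoydEtAl2011, §3.2 Assumption 1] -/
structure IsConvex : Prop where
  /-- `f` is convex on `dom f` -/
  convexOn_f : ConvexOn ℝ P.domf P.f
  /-- `g` is convex on `dom g` -/
  convexOn_g : ConvexOn ℝ P.domg P.g

/-- ASSUMPTION 2 of [BPCPE11, §3.2]: `(x⋆, z⋆, y⋆)` is a saddle point of the unaugmented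
Lagrangian, `L_0(x⋆, z⋆, y) ≤ L_0(x⋆, z⋆, y⋆) ≤ L_0(x, z, y⋆)` for all `x ∈ dom f`, `z ∈ dom g`
and all `y`. [cite: BoydEtAl2011, §3.2 Assumption 2] -/
structure IsSaddlePoint (xs : E₁) (zs : E₂) (ys : F) : Prop where
  /-- `x⋆ ∈ dom f` -/
  x_mem : xs ∈ P.domf
  /-- `z⋆ ∈ dom g` -/
  z_mem : zs ∈ P.domg
  /-- `L_0(x⋆, z⋆, y) ≤ L_0(x⋆, z⋆, y⋆)` for all `y` -/
  le_left : ∀ y : F, P.augLagrangian 0 xs zs y ≤ P.augLagrangian 0 xs zs ys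
  /-- `L_0(x⋆, z⋆, y⋆) ≤ L_0(x, z, y⋆)` for all `x ∈ dom f`, `z ∈ dom g` -/
  le_right : ∀ x ∈ P.domf, ∀ z ∈ P.domg, P.augLagrangian 0 xs zs ys ≤ P.augLagrangian 0 x z ys

/-- THE ADMM ITERATES (3.2)–(3.4) of [BPCPE11, §3.1] with penalty parameter `ρ`, as data:
for every `k`, `x^{k+1} ∈ dom f` minimises `L_ρ(·, z^k, y^k)` over `dom f` (3.2),
`z^{k+1} ∈ dom g` minimises `L_ρ(x^{k+1}, ·, y^k)` over `dom g` (3.3), and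
`y^{k+1} = y^k + ρ(Ax^{k+1} + Bz^{k+1} − c)` (3.4).  (`x^0` is never used and `z^0`, `y^0` are
arbitrary: "the algorithm state in ADMM consists of `z^k` and `y^k`", p. 14.)
[cite: BoydEtAl2011, §3.1 (3.2)–(3.4)] -/
structure IsADMMSeq (ρ : ℝ) (x : ℕ → E₁) (z : ℕ → E₂) (y : ℕ → F) : Prop where
  /-- `x^{k+1} ∈ dom f` -/
  x_mem : ∀ k, x (k + 1) ∈ P.domf
  /-- `z^{k+1} ∈ dom g` -/
  z_mem : ∀ k, z (k + 1) ∈ P.domg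
  /-- (3.2): `x^{k+1} ∈ argmin_x L_ρ(x, z^k, y^k)` -/
  x_min : ∀ k, IsMinOn (fun x' => P.augLagrangian ρ x' (z k) (y k)) P.domf (x (k + 1))
  /-- (3.3): `z^{k+1} ∈ argmin_z L_ρ(x^{k+1}, z, y^k)` -/
  z_min : ∀ k, IsMinOn (fun z' => P.augLagrangian ρ (x (k + 1)) z' (y k)) P.domg (z (k + 1))
  /-- (3.4): `y^{k+1} = y^k + ρ(Ax^{k+1} + Bz^{k+1} − c)` -/
  y_step : ∀ k, y (k + 1) = y k + ρ • P.residual (x (k + 1)) (z (k + 1))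

/-- The Lyapunov function of Appendix A, `V^k = (1/ρ)‖y^k − y⋆‖₂² + ρ‖B(z^k − z⋆)‖₂²`.
[cite: BoydEtAl2011, Appendix A] -/
def lyapunov (ρ : ℝ) (zs : E₂) (ys : F) (z : ℕ → E₂) (y : ℕ → F) (k : ℕ) : ℝ :=
  1 / ρ * ‖y k - ys‖ ^ 2 + ρ * ‖P.B (z k - zs)‖ ^ 2

/-! ## §3.1.1: the scaled form -/

/-- The identity behind the SCALED FORM of ADMM [BPCPE11, §3.1.1]:
`yᵀr + (ρ/2)‖r‖₂² = (ρ/2)‖r + (1/ρ)y‖₂² − (1/2ρ)‖y‖₂²` (`ρ ≠ 0`).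
[cite: BoydEtAl2011, §3.1.1] -/
theorem inner_add_norm_sq_eq_scaled (y r : F) {ρ : ℝ} (hρ : ρ ≠ 0) :
    ⟪y, r⟫ + ρ / 2 * ‖r‖ ^ 2 = ρ / 2 * ‖r + (1 / ρ) • y‖ ^ 2 - 1 / (2 * ρ) * ‖y‖ ^ 2 := by
  rw [norm_add_sq_real, real_inner_smul_right, norm_smul, mul_pow, Real.norm_eq_abs, sq_abs,
    real_inner_comm]
  field_simp
  ring

namespace IsSaddlePoint

variable {P} {xs : E₁} {zs : E₂} {ys : F}

/-- A saddle point of `L_0` is primal feasible: `Ax⋆ + Bz⋆ = c` [BPCPE11, §3.2, after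
Assumption 2: "This implies that `(x⋆, z⋆)` is a solution to (3.1), so `Ax⋆ + Bz⋆ = c`"].
[cite: BoydEtAl2011, §3.2 Assumption 2] -/
theorem residual_eq_zero (h : P.IsSaddlePoint xs zs ys) : P.residual xs zs = 0 := by
  have h1 := h.le_left (ys + P.residual xs zs)
  rw [augLagrangian_zero, augLagrangian_zero, inner_add_left, real_inner_self_eq_norm_sq] at h1
  have h2 : ‖P.residual xs zs‖ ^ 2 ≤ 0 := by linarith
  have h3 : ‖P.residual xs zs‖ ^ 2 = 0 := le_antisymm h2 (by positivity)
  exact norm_eq_zero.mp (pow_eq_zero_iff two_ne_zero |>.mp h3)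

/-- `Ax⋆ + Bz⋆ = c`. [cite: BoydEtAl2011, §3.2 Assumption 2] -/
theorem feasible (h : P.IsSaddlePoint xs zs ys) : P.A xs + P.B zs = P.c :=
  sub_eq_zero.mp h.residual_eq_zero

/-- `L_0(x⋆, z⋆, y⋆) = p⋆ = f(x⋆) + g(z⋆)` ("Using `Ax⋆ + Bz⋆ = c`, the lefthand side is `p⋆`",
App. A, proof of (A.3)). [cite: BoydEtAl2011, Appendix A, proof of (A.3)] -/
theorem augLagrangian_eq_objective (h : P.IsSaddlePoint xs zs ys) (y : F) :
    P.augLagrangian 0 xs zs y = P.objective xs zs := by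
  rw [augLagrangian_zero, h.residual_eq_zero, inner_zero_right, add_zero]

/-- The right saddle inequality read with feasibility: `p⋆ ≤ f(x) + g(z) + y⋆ᵀ(Ax + Bz − c)` for
all `x ∈ dom f`, `z ∈ dom g`. [cite: BoydEtAl2011, Appendix A, proof of (A.3)] -/
theorem objective_le (h : P.IsSaddlePoint xs zs ys) {x : E₁} (hx : x ∈ P.domf) {z : E₂}
    (hz : z ∈ P.domg) : P.objective xs zs ≤ P.objective x z + ⟪ys, P.residual x z⟫ := by
  have := h.le_right x hx z hz
  rwa [h.augLagrangian_eq_objective, augLagrangian_zero] at this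

/-- A saddle point is OPTIMAL for (3.1): `p⋆ ≤ f(x) + g(z)` for every feasible `(x, z)`
[BPCPE11, §3.2: "`(x⋆, z⋆)` is a solution to (3.1)"]. [cite: BoydEtAl2011, §3.2 Assumption 2] -/
theorem objective_le_of_feasible (h : P.IsSaddlePoint xs zs ys) {x : E₁} (hx : x ∈ P.domf)
    {z : E₂} (hz : z ∈ P.domg) (hfeas : P.A x + P.B z = P.c) :
    P.objective xs zs ≤ P.objective x z := by
  have := h.objective_le hx hz
  rwa [residual, hfeas, sub_self, inner_zero_right, add_zero] at this

end IsSaddlePoint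

namespace IsADMMSeq

variable {P} {ρ : ℝ} {x : ℕ → E₁} {z : ℕ → E₂} {y : ℕ → F} {xs : E₁} {zs : E₂} {ys : F}

/-- (3.4) solved for the residual: `r^{k+1} = (1/ρ)(y^{k+1} − y^k)`.
[cite: BoydEtAl2011, §3.1 (3.4)] -/
theorem residual_eq_inv_smul (h : P.IsADMMSeq ρ x z y) (hρ : ρ ≠ 0) (k : ℕ) :
    P.residual (x (k + 1)) (z (k + 1)) = (1 / ρ) • (y (k + 1) - y k) := by
  rw [h.y_step k, add_sub_cancel_left, smul_smul, one_div, inv_mul_cancel₀ hρ, one_smul]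

/-- The scaled dual variable is the running sum of the residuals:
`u^k = u^0 + Σ_{j=1}^{k} r^j`, `u = (1/ρ)y` [BPCPE11, §3.1.1].  (Here the sum runs over
`j + 1`, `j < k`.) [cite: BoydEtAl2011, §3.1.1] -/
theorem inv_smul_y_eq_sum (h : P.IsADMMSeq ρ x z y) (hρ : ρ ≠ 0) (k : ℕ) :
    (1 / ρ) • y k = (1 / ρ) • y 0 + ∑ j ∈ Finset.range k, P.residual (x (j + 1)) (z (j + 1)) := by
  induction k with
  | zero => simp
  | succ k ih =>
    rw [Finset.sum_range_succ, ← add_assoc, ← ih, h.residual_eq_inv_smul hρ k, ← smul_add,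
      add_sub_cancel]

/-! ### §3.3: the linearised optimality of the two updates -/

/-- [BPCPE11, §3.3, (3.10) and the display before it]: since `z^{k+1}` minimises
`L_ρ(x^{k+1}, z, y^k)`, it minimises `g(z) + (y^{k+1})ᵀBz` over `dom g` — "`z^{k+1}` and
`y^{k+1}` always satisfy (3.10)", `0 ∈ ∂g(z^{k+1}) + Bᵀy^{k+1}`.
[cite: BoydEtAl2011, §3.3 (3.10)] -/
theorem z_isMinOn_linear (h : P.IsADMMSeq ρ x z y) (hP : P.IsConvex) (hρ : 0 ≤ ρ) (k : ℕ) :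
    IsMinOn (fun z' => P.g z' + ⟪y (k + 1), P.B z'⟫) P.domg (z (k + 1)) := by
  have hφ : ConvexOn ℝ P.domg (fun z' => P.g z' + P.f (x (k + 1))) := by
    simpa [Pi.add_def] using hP.convexOn_g.add (convexOn_const (P.f (x (k + 1))) hP.convexOn_g.1)
  have e : (fun z' => P.augLagrangian ρ (x (k + 1)) z' (y k)) = fun z' =>
      (P.g z' + P.f (x (k + 1))) + ⟪y k, P.B z' + (P.A (x (k + 1)) - P.c)⟫ +
        ρ / 2 * ‖P.B z' + (P.A (x (k + 1)) - P.c)‖ ^ 2 := by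
    funext z'
    have hr : P.residual (x (k + 1)) z' = P.B z' + (P.A (x (k + 1)) - P.c) := by
      rw [residual]; abel
    rw [augLagrangian, hr, objective, add_comm (P.f _)]
  have hmin := h.z_min k
  rw [e] at hmin
  have key := isMinOn_linearised hφ P.B (y k) (P.A (x (k + 1)) - P.c) hρ (h.z_mem k) hmin
  have ey : y k + ρ • (P.B (z (k + 1)) + (P.A (x (k + 1)) - P.c)) = y (k + 1) := by
    rw [h.y_step k, residual]
    congr 1
    abel_nf
  rw [ey] at key
  rw [isMinOn_iff] at key ⊢
  intro z' hz'
  have := key z' hz'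
  linarith

/-- [BPCPE11, §3.3, the display after (3.10); App. A, proof of (A.2)]: since `x^{k+1}` minimises
`L_ρ(x, z^k, y^k)`, it minimises `f(x) + (y^{k+1} − ρB(z^{k+1} − z^k))ᵀAx` over `dom f`
(`ρAᵀB(z^{k+1} − z^k) ∈ ∂f(x^{k+1}) + Aᵀy^{k+1}` — the origin of the dual residual).
[cite: BoydEtAl2011, §3.3] -/
theorem x_isMinOn_linear (h : P.IsADMMSeq ρ x z y) (hP : P.IsConvex) (hρ : 0 ≤ ρ) (k : ℕ) :
    IsMinOn (fun x' => P.f x' + ⟪y (k + 1) - ρ • P.B (z (k + 1) - z k), P.A x'⟫) P.domf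
      (x (k + 1)) := by
  have hφ : ConvexOn ℝ P.domf (fun x' => P.f x' + P.g (z k)) := by
    simpa [Pi.add_def] using hP.convexOn_f.add (convexOn_const (P.g (z k)) hP.convexOn_f.1)
  have e : (fun x' => P.augLagrangian ρ x' (z k) (y k)) = fun x' =>
      (P.f x' + P.g (z k)) + ⟪y k, P.A x' + (P.B (z k) - P.c)⟫ +
        ρ / 2 * ‖P.A x' + (P.B (z k) - P.c)‖ ^ 2 := by
    funext x'
    have hr : P.residual x' (z k) = P.A x' + (P.B (z k) - P.c) := by
      rw [residual]; abel
    rw [augLagrangian, hr, objective]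
  have hmin := h.x_min k
  rw [e] at hmin
  have key := isMinOn_linearised hφ P.A (y k) (P.B (z k) - P.c) hρ (h.x_mem k) hmin
  have ey : y k + ρ • (P.A (x (k + 1)) + (P.B (z k) - P.c)) =
      y (k + 1) - ρ • P.B (z (k + 1) - z k) := by
    rw [h.y_step k, residual, map_sub]
    simp only [smul_add, smul_sub]
    abel
  rw [ey] at key
  rw [isMinOn_iff] at key ⊢
  intro x' hx'
  have := key x' hx'
  linarith

/-! ### Appendix A: the three key inequalities -/

/-- **(A.3)**: `p⋆ − p^{k+1} ≤ y⋆ᵀ r^{k+1}` (from `L_0(x⋆, z⋆, y⋆) ≤ L_0(x^{k+1}, z^{k+1}, y⋆)`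
and `Ax⋆ + Bz⋆ = c`). [cite: BoydEtAl2011, Appendix A (A.3)] -/
theorem optimal_sub_objective_le (h : P.IsADMMSeq ρ x z y) (hs : P.IsSaddlePoint xs zs ys)
    (k : ℕ) :
    P.objective xs zs - P.objective (x (k + 1)) (z (k + 1)) ≤
      ⟪ys, P.residual (x (k + 1)) (z (k + 1))⟫ := by
  have := hs.objective_le (h.x_mem k) (h.z_mem k)
  linarith

/-- **(A.2)**:
`p^{k+1} − p⋆ ≤ −(y^{k+1})ᵀr^{k+1} − ρ(B(z^{k+1} − z^k))ᵀ(−r^{k+1} + B(z^{k+1} − z⋆))`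
(add the two linearised optimality inequalities at `x⋆`, `z⋆` and use `Ax⋆ + Bz⋆ = c`).
[cite: BoydEtAl2011, Appendix A (A.2)] -/
theorem objective_sub_optimal_le (h : P.IsADMMSeq ρ x z y) (hP : P.IsConvex) (hρ : 0 ≤ ρ)
    (hs : P.IsSaddlePoint xs zs ys) (k : ℕ) :
    P.objective (x (k + 1)) (z (k + 1)) - P.objective xs zs ≤
      -⟪y (k + 1), P.residual (x (k + 1)) (z (k + 1))⟫ -
        ρ * ⟪P.B (z (k + 1) - z k),
          -P.residual (x (k + 1)) (z (k + 1)) + P.B (z (k + 1) - zs)⟫ := by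
  have hx := (isMinOn_iff.mp (h.x_isMinOn_linear hP hρ k)) xs hs.x_mem
  have hz := (isMinOn_iff.mp (h.z_isMinOn_linear hP hρ k)) zs hs.z_mem
  have e1 : P.A xs - P.A (x (k + 1)) =
      -P.residual (x (k + 1)) (z (k + 1)) + P.B (z (k + 1) - zs) := by
    rw [residual, ← hs.feasible, map_sub]
    abel
  calc P.objective (x (k + 1)) (z (k + 1)) - P.objective xs zs
      ≤ ⟪y (k + 1) - ρ • P.B (z (k + 1) - z k), P.A xs - P.A (x (k + 1))⟫ +
          ⟪y (k + 1), P.B zs - P.B (z (k + 1))⟫ := by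
        rw [inner_sub_right, inner_sub_right (y (k + 1))]
        simp only [objective]
        linarith
    _ = _ := by
        rw [e1]
        have e2 : P.B zs - P.B (z (k + 1)) = -P.B (z (k + 1) - zs) := by rw [map_sub]; abel
        rw [e2, inner_neg_right, inner_sub_left, real_inner_smul_left,
          inner_add_right (y (k + 1)), inner_neg_right]
        ring

/-- **(3.11)**, the form of (A.2) with the dual residual: since
`−r^{k+1} + B(z^{k+1} − z^k) = −A(x^{k+1} − x⋆)`,
`p^{k+1} − p⋆ ≤ −(y^{k+1})ᵀr^{k+1} + (x^{k+1} − x⋆)ᵀ s^{k+1}` with `s^{k+1} = ρAᵀB(z^{k+1} − z^k)`,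
written adjoint-free as `ρ⟪B(z^{k+1} − z^k), A(x^{k+1} − x⋆)⟫`.
[cite: BoydEtAl2011, §3.3.1 (3.11)] -/
theorem objective_sub_optimal_le' (h : P.IsADMMSeq ρ x z y) (hP : P.IsConvex) (hρ : 0 ≤ ρ)
    (hs : P.IsSaddlePoint xs zs ys) (k : ℕ) :
    P.objective (x (k + 1)) (z (k + 1)) - P.objective xs zs ≤
      -⟪y (k + 1), P.residual (x (k + 1)) (z (k + 1))⟫ +
        ρ * ⟪P.B (z (k + 1) - z k), P.A (x (k + 1) - xs)⟫ := by
  have h1 := h.objective_sub_optimal_le hP hρ hs k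
  have e : -P.residual (x (k + 1)) (z (k + 1)) + P.B (z (k + 1) - zs) = -P.A (x (k + 1) - xs) := by
    rw [residual, ← hs.feasible, map_sub, map_sub]
    abel
  rw [e, inner_neg_right] at h1
  linarith

/-- The vector algebra of [BPCPE11, App. A, "Proof of inequality (A.1)"] from (A.4) to (A.6):
with `u = y^k − y⋆`, `r = r^{k+1}`, `d = B(z^{k+1} − z^k)`, `e = B(z^k − z⋆)` (so that
`y^{k+1} − y⋆ = u + ρr` and `B(z^{k+1} − z⋆) = e + d`), the inequality
`(u + ρr)ᵀr − ρdᵀr + ρdᵀ(e + d) ≤ 0` (half of (A.4)) gives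
`V^k − V^{k+1} ≥ ρ‖r − d‖²` (A.6). [folklore] -/
private theorem lyapunov_algebra (u r d e : F) {ρ : ℝ} (hρ : 0 < ρ)
    (h : ⟪u + ρ • r, r⟫ - ρ * ⟪d, r⟫ + ρ * ⟪d, e + d⟫ ≤ 0) :
    ρ * ‖r - d‖ ^ 2 ≤
      (1 / ρ * ‖u‖ ^ 2 + ρ * ‖e‖ ^ 2) - (1 / ρ * ‖u + ρ • r‖ ^ 2 + ρ * ‖e + d‖ ^ 2) := by
  have hρ' : ρ ≠ 0 := hρ.ne'
  have h1 : ‖u + ρ • r‖ ^ 2 = ‖u‖ ^ 2 + 2 * ρ * ⟪u, r⟫ + ρ ^ 2 * ‖r‖ ^ 2 := by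
    rw [norm_add_sq_real, real_inner_smul_right, norm_smul, mul_pow, Real.norm_eq_abs, sq_abs]
    ring
  have h2 : ‖e + d‖ ^ 2 = ‖e‖ ^ 2 + 2 * ⟪d, e⟫ + ‖d‖ ^ 2 := by
    rw [norm_add_sq_real, real_inner_comm]
  have h3 : ‖r - d‖ ^ 2 = ‖r‖ ^ 2 - 2 * ⟪d, r⟫ + ‖d‖ ^ 2 := by
    rw [norm_sub_sq_real, real_inner_comm]
  have h4 : ⟪u + ρ • r, r⟫ = ⟪u, r⟫ + ρ * ‖r‖ ^ 2 := by
    rw [inner_add_left, real_inner_smul_left, real_inner_self_eq_norm_sq]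
  have h5 : ⟪d, e + d⟫ = ⟪d, e⟫ + ‖d‖ ^ 2 := by
    rw [inner_add_right, real_inner_self_eq_norm_sq]
  have e6 : (1 / ρ * ‖u‖ ^ 2 + ρ * ‖e‖ ^ 2) - (1 / ρ * ‖u + ρ • r‖ ^ 2 + ρ * ‖e + d‖ ^ 2) =
      -2 * ⟪u, r⟫ - ρ * ‖r‖ ^ 2 - 2 * ρ * ⟪d, e⟫ - ρ * ‖d‖ ^ 2 := by
    rw [h1, h2]
    field_simp
    ring
  rw [e6, h3]
  rw [h4, h5] at h
  nlinarith [h, hρ]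

/-- **(A.6)**: `V^k − V^{k+1} ≥ ρ‖r^{k+1} − B(z^{k+1} − z^k)‖₂²` for EVERY `k` (obtained from
(A.2) + (A.3), i.e. (A.4), by completing squares, (A.5)). [cite: BoydEtAl2011, Appendix A (A.6)] -/
theorem lyapunov_sub_succ_ge (h : P.IsADMMSeq ρ x z y) (hP : P.IsConvex) (hρ : 0 < ρ)
    (hs : P.IsSaddlePoint xs zs ys) (k : ℕ) :
    ρ * ‖P.residual (x (k + 1)) (z (k + 1)) - P.B (z (k + 1) - z k)‖ ^ 2 ≤
      P.lyapunov ρ zs ys z y k - P.lyapunov ρ zs ys z y (k + 1) := by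
  have hA2 := h.objective_sub_optimal_le hP hρ.le hs k
  have hA3 := h.optimal_sub_objective_le hs k
  have hy : y (k + 1) - ys = (y k - ys) + ρ • P.residual (x (k + 1)) (z (k + 1)) := by
    rw [h.y_step k]; abel
  have he : P.B (z (k + 1) - zs) = P.B (z k - zs) + P.B (z (k + 1) - z k) := by
    rw [← map_add]; congr 1; abel
  have hsum : ⟪(y k - ys) + ρ • P.residual (x (k + 1)) (z (k + 1)),
        P.residual (x (k + 1)) (z (k + 1))⟫ -
      ρ * ⟪P.B (z (k + 1) - z k), P.residual (x (k + 1)) (z (k + 1))⟫ +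
      ρ * ⟪P.B (z (k + 1) - z k), P.B (z k - zs) + P.B (z (k + 1) - z k)⟫ ≤ 0 := by
    rw [← hy, ← he, inner_sub_left]
    rw [inner_add_right, inner_neg_right] at hA2
    linarith
  have := lyapunov_algebra (y k - ys) (P.residual (x (k + 1)) (z (k + 1)))
    (P.B (z (k + 1) - z k)) (P.B (z k - zs)) hρ hsum
  simpa only [lyapunov, hy, he] using this

/-- The sign of the cross term [BPCPE11, App. A, last paragraph]: `z^{k+1}` minimises
`g(z) + (y^{k+1})ᵀBz` and `z^{k+2}` minimises `g(z) + (y^{k+2})ᵀBz`, so adding the two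
optimality inequalities gives `(y^{k+2} − y^{k+1})ᵀB(z^{k+2} − z^{k+1}) ≤ 0`, i.e.
`(r^{k+2})ᵀ B(z^{k+2} − z^{k+1}) ≤ 0` (indices shifted by one: both points must be `z`-updates).
[cite: BoydEtAl2011, Appendix A, proof of (A.1)] -/
theorem inner_residual_map_sub_nonpos (h : P.IsADMMSeq ρ x z y) (hP : P.IsConvex) (hρ : 0 < ρ)
    (k : ℕ) :
    ⟪P.residual (x (k + 1 + 1)) (z (k + 1 + 1)), P.B (z (k + 1 + 1) - z (k + 1))⟫ ≤ 0 := by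
  have h1 := isMinOn_iff.mp (h.z_isMinOn_linear hP hρ.le (k + 1)) (z (k + 1)) (h.z_mem k)
  have h2 := isMinOn_iff.mp (h.z_isMinOn_linear hP hρ.le k) (z (k + 1 + 1)) (h.z_mem (k + 1))
  have e : y (k + 1 + 1) - y (k + 1) = ρ • P.residual (x (k + 1 + 1)) (z (k + 1 + 1)) := by
    rw [h.y_step (k + 1)]; abel
  have h3 : ⟪y (k + 1 + 1) - y (k + 1), P.B (z (k + 1 + 1) - z (k + 1))⟫ ≤ 0 := by
    rw [map_sub, inner_sub_left, inner_sub_right, inner_sub_right]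
    linarith
  rw [e, real_inner_smul_left] at h3
  refine le_of_mul_le_mul_left ?_ hρ
  rw [mul_zero]
  exact h3

/-- **(A.1)**: `V^{k+1} ≤ V^k − ρ‖r^{k+1}‖₂² − ρ‖B(z^{k+1} − z^k)‖₂²`, for `k ≥ 1` (indices
written `k + 1 ↦ k + 2`; see the module docstring, "THE INDEX IN (A.1)": the step needs `z^k` to
be a `z`-update). [cite: BoydEtAl2011, Appendix A (A.1)] -/
theorem lyapunov_succ_le (h : P.IsADMMSeq ρ x z y) (hP : P.IsConvex) (hρ : 0 < ρ)
    (hs : P.IsSaddlePoint xs zs ys) (k : ℕ) :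
    P.lyapunov ρ zs ys z y (k + 1 + 1) ≤ P.lyapunov ρ zs ys z y (k + 1) -
      ρ * ‖P.residual (x (k + 1 + 1)) (z (k + 1 + 1))‖ ^ 2 -
        ρ * ‖P.B (z (k + 1 + 1) - z (k + 1))‖ ^ 2 := by
  have h6 := h.lyapunov_sub_succ_ge hP hρ hs (k + 1)
  have hc := h.inner_residual_map_sub_nonpos hP hρ k
  rw [norm_sub_sq_real] at h6
  have : ρ * ⟪P.residual (x (k + 1 + 1)) (z (k + 1 + 1)), P.B (z (k + 1 + 1) - z (k + 1))⟫ ≤ 0 :=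
    mul_nonpos_iff.mpr (Or.inl ⟨hρ.le, hc⟩)
  linarith

/-- `V^{k+1} ≤ V^k` for every `k` ("a nonnegative quantity that decreases in each iteration";
from (A.6)). [cite: BoydEtAl2011, Appendix A (A.6)] -/
theorem lyapunov_succ_le_self (h : P.IsADMMSeq ρ x z y) (hP : P.IsConvex) (hρ : 0 < ρ)
    (hs : P.IsSaddlePoint xs zs ys) (k : ℕ) :
    P.lyapunov ρ zs ys z y (k + 1) ≤ P.lyapunov ρ zs ys z y k := by
  have h6 := h.lyapunov_sub_succ_ge hP hρ hs k
  have : 0 ≤ ρ * ‖P.residual (x (k + 1)) (z (k + 1)) - P.B (z (k + 1) - z k)‖ ^ 2 := by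
    positivity
  linarith

/-- `V^k` is nonincreasing in `k`. [cite: BoydEtAl2011, Appendix A (A.1)] -/
theorem lyapunov_antitone (h : P.IsADMMSeq ρ x z y) (hP : P.IsConvex) (hρ : 0 < ρ)
    (hs : P.IsSaddlePoint xs zs ys) : Antitone (P.lyapunov ρ zs ys z y) :=
  antitone_nat_of_succ_le fun k => h.lyapunov_succ_le_self hP hρ hs k

/-- `V^k ≥ 0`. [cite: BoydEtAl2011, Appendix A] -/
theorem lyapunov_nonneg (hρ : 0 < ρ) (k : ℕ) : 0 ≤ P.lyapunov ρ zs ys z y k := by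
  unfold lyapunov
  positivity

/-- `V^k ≤ V^0`. [cite: BoydEtAl2011, Appendix A] -/
theorem lyapunov_le_zero (h : P.IsADMMSeq ρ x z y) (hP : P.IsConvex) (hρ : 0 < ρ)
    (hs : P.IsSaddlePoint xs zs ys) (k : ℕ) :
    P.lyapunov ρ zs ys z y k ≤ P.lyapunov ρ zs ys z y 0 :=
  h.lyapunov_antitone hP hρ hs (Nat.zero_le k)

/-- "Because `V^k ≤ V^0`, it follows that `y^k` … [is] bounded": `‖y^k − y⋆‖₂² ≤ ρV^0`.
[cite: BoydEtAl2011, Appendix A] -/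
theorem norm_y_sub_sq_le (h : P.IsADMMSeq ρ x z y) (hP : P.IsConvex) (hρ : 0 < ρ)
    (hs : P.IsSaddlePoint xs zs ys) (k : ℕ) :
    ‖y k - ys‖ ^ 2 ≤ ρ * P.lyapunov ρ zs ys z y 0 := by
  have h1 := h.lyapunov_le_zero hP hρ hs k
  have h2 : ‖y k - ys‖ ^ 2 = ρ * (1 / ρ * ‖y k - ys‖ ^ 2) := by
    field_simp
  have h3 : 0 ≤ ρ * ‖P.B (z k - zs)‖ ^ 2 := by positivity
  rw [h2]
  have h4 : 1 / ρ * ‖y k - ys‖ ^ 2 ≤ P.lyapunov ρ zs ys z y 0 := by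
    unfold lyapunov at h1 ⊢; linarith
  exact mul_le_mul_of_nonneg_left h4 hρ.le

/-- "… and `Bz^k` [is] bounded": `ρ‖B(z^k − z⋆)‖₂² ≤ V^0`. [cite: BoydEtAl2011, Appendix A] -/
theorem norm_map_sub_sq_le (h : P.IsADMMSeq ρ x z y) (hP : P.IsConvex) (hρ : 0 < ρ)
    (hs : P.IsSaddlePoint xs zs ys) (k : ℕ) :
    ρ * ‖P.B (z k - zs)‖ ^ 2 ≤ P.lyapunov ρ zs ys z y 0 := by
  have h1 := h.lyapunov_le_zero hP hρ hs k
  have h3 : 0 ≤ 1 / ρ * ‖y k - ys‖ ^ 2 := by positivity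
  unfold lyapunov at h1 h3 ⊢
  linarith

/-- "Iterating the inequality above gives
`ρ Σ_k (‖r^{k+1}‖₂² + ‖B(z^{k+1} − z^k)‖₂²) ≤ V`": the partial sums from `k = 1`
(indices `k + 2`) are bounded by `V^1/ρ`. [cite: BoydEtAl2011, Appendix A] -/
theorem sum_range_le (h : P.IsADMMSeq ρ x z y) (hP : P.IsConvex) (hρ : 0 < ρ)
    (hs : P.IsSaddlePoint xs zs ys) (N : ℕ) :
    ∑ k ∈ Finset.range N, (‖P.residual (x (k + 1 + 1)) (z (k + 1 + 1))‖ ^ 2 +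
        ‖P.B (z (k + 1 + 1) - z (k + 1))‖ ^ 2) ≤ P.lyapunov ρ zs ys z y 1 / ρ := by
  have hterm : ∀ k, ρ * (‖P.residual (x (k + 1 + 1)) (z (k + 1 + 1))‖ ^ 2 +
      ‖P.B (z (k + 1 + 1) - z (k + 1))‖ ^ 2) ≤
        P.lyapunov ρ zs ys z y (k + 1) - P.lyapunov ρ zs ys z y (k + 1 + 1) := by
    intro k
    have := h.lyapunov_succ_le hP hρ hs k
    linarith
  have htel : ∀ n : ℕ, ∑ k ∈ Finset.range n,
      (P.lyapunov ρ zs ys z y (k + 1) - P.lyapunov ρ zs ys z y (k + 1 + 1)) =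
        P.lyapunov ρ zs ys z y 1 - P.lyapunov ρ zs ys z y (n + 1) := by
    intro n
    induction n with
    | zero => simp
    | succ n ih => rw [Finset.sum_range_succ, ih]; ring
  have hle : ρ * ∑ k ∈ Finset.range N, (‖P.residual (x (k + 1 + 1)) (z (k + 1 + 1))‖ ^ 2 +
      ‖P.B (z (k + 1 + 1) - z (k + 1))‖ ^ 2) ≤
        P.lyapunov ρ zs ys z y 1 - P.lyapunov ρ zs ys z y (N + 1) := by
    rw [Finset.mul_sum, ← htel N]
    exact Finset.sum_le_sum fun k _ => hterm k
  have hVN : 0 ≤ P.lyapunov ρ zs ys z y (N + 1) := lyapunov_nonneg hρ (N + 1)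
  rw [le_div_iff₀ hρ]
  linarith

/-- The series `Σ_{k ≥ 1} (‖r^{k+1}‖₂² + ‖B(z^{k+1} − z^k)‖₂²)` converges.
[cite: BoydEtAl2011, Appendix A] -/
theorem summable_sq (h : P.IsADMMSeq ρ x z y) (hP : P.IsConvex) (hρ : 0 < ρ)
    (hs : P.IsSaddlePoint xs zs ys) :
    Summable (fun k => ‖P.residual (x (k + 1 + 1)) (z (k + 1 + 1))‖ ^ 2 +
        ‖P.B (z (k + 1 + 1) - z (k + 1))‖ ^ 2) :=
  summable_of_sum_range_le (fun k => by positivity) (fun N => h.sum_range_le hP hρ hs N)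

/-! ### §3.2.1: residual and objective convergence -/

omit [InnerProductSpace ℝ F] in
/-- From `‖v_k‖² → 0` to `v_k → 0`. [folklore] -/
private theorem tendsto_of_norm_sq {v : ℕ → F}
    (hv : Tendsto (fun k => ‖v k‖ ^ 2) atTop (𝓝 0)) : Tendsto v atTop (𝓝 0) := by
  have h1 : Tendsto (fun k => Real.sqrt (‖v k‖ ^ 2)) atTop (𝓝 (Real.sqrt 0)) :=
    (Real.continuous_sqrt.tendsto 0).comp hv
  rw [Real.sqrt_zero] at h1
  have h2 : Tendsto (fun k => ‖v k‖) atTop (𝓝 0) := by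
    refine h1.congr' (Eventually.of_forall fun k => ?_)
    exact Real.sqrt_sq (norm_nonneg _)
  exact tendsto_zero_iff_norm_tendsto_zero.mpr h2

/-- **RESIDUAL CONVERGENCE** [BPCPE11, §3.2.1]: `r^k = Ax^k + Bz^k − c → 0`, "the iterates
approach feasibility". [cite: BoydEtAl2011, §3.2.1] -/
theorem tendsto_residual (h : P.IsADMMSeq ρ x z y) (hP : P.IsConvex) (hρ : 0 < ρ)
    (hs : P.IsSaddlePoint xs zs ys) :
    Tendsto (fun k => P.residual (x k) (z k)) atTop (𝓝 0) := by
  have h1 := (h.summable_sq hP hρ hs).tendsto_atTop_zero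
  have h2 : Tendsto (fun k => ‖P.residual (x (k + 1 + 1)) (z (k + 1 + 1))‖ ^ 2) atTop (𝓝 0) :=
    squeeze_zero (fun k => by positivity) (fun k => le_add_of_nonneg_right (by positivity)) h1
  have h3 := tendsto_of_norm_sq h2
  exact (tendsto_add_atTop_iff_nat 2).mp h3

/-- `B(z^{k+1} − z^k) → 0` [BPCPE11, App. A: "which implies that `r^k → 0` and
`B(z^{k+1} − z^k) → 0` as `k → ∞`"]. [cite: BoydEtAl2011, Appendix A] -/
theorem tendsto_map_sub (h : P.IsADMMSeq ρ x z y) (hP : P.IsConvex) (hρ : 0 < ρ)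
    (hs : P.IsSaddlePoint xs zs ys) :
    Tendsto (fun k => P.B (z (k + 1) - z k)) atTop (𝓝 0) := by
  have h1 := (h.summable_sq hP hρ hs).tendsto_atTop_zero
  have h2 : Tendsto (fun k => ‖P.B (z (k + 1 + 1) - z (k + 1))‖ ^ 2) atTop (𝓝 0) :=
    squeeze_zero (fun k => by positivity) (fun k => le_add_of_nonneg_left (by positivity)) h1
  have h3 := tendsto_of_norm_sq h2
  exact (tendsto_add_atTop_iff_nat (f := fun k => P.B (z (k + 1) - z k)) 1).mp h3

/-- DUAL RESIDUAL CONVERGENCE [BPCPE11, §3.3 and App. A: "Multiplying the second expression by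
`ρAᵀ` shows that the dual residual `s^k = ρAᵀB(z^{k+1} − z^k)` converges to zero"]: for any
continuous linear map `Aadj` (the adjoint `Aᵀ` when `E₁` carries an inner product),
`ρ Aadj (B(z^{k+1} − z^k)) → 0`. [cite: BoydEtAl2011, Appendix A] -/
theorem tendsto_dualResidual {G : Type*} [NormedAddCommGroup G] [NormedSpace ℝ G]
    (h : P.IsADMMSeq ρ x z y) (hP : P.IsConvex) (hρ : 0 < ρ) (hs : P.IsSaddlePoint xs zs ys)
    (Aadj : F →L[ℝ] G) :
    Tendsto (fun k => ρ • Aadj (P.B (z (k + 1) - z k))) atTop (𝓝 0) := by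
  have h1 := h.tendsto_map_sub hP hρ hs
  have h2 : Tendsto (fun k => Aadj (P.B (z (k + 1) - z k))) atTop (𝓝 0) := by
    have := (Aadj.continuous.tendsto 0).comp h1
    rw [map_zero] at this
    exact this
  have h3 := h2.const_smul ρ
  rw [smul_zero] at h3
  exact h3

/-- A uniform bound on the residuals: `‖r^{k+1}‖ = (1/ρ)‖y^{k+1} − y^k‖ ≤ (2/ρ)√(ρV^0)`.
[cite: BoydEtAl2011, Appendix A] -/
theorem norm_residual_le (h : P.IsADMMSeq ρ x z y) (hP : P.IsConvex) (hρ : 0 < ρ)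
    (hs : P.IsSaddlePoint xs zs ys) (k : ℕ) :
    ‖P.residual (x (k + 1)) (z (k + 1))‖ ≤ 2 / ρ * Real.sqrt (ρ * P.lyapunov ρ zs ys z y 0) := by
  have hb : ∀ j, ‖y j - ys‖ ≤ Real.sqrt (ρ * P.lyapunov ρ zs ys z y 0) := by
    intro j
    rw [← Real.sqrt_sq (norm_nonneg (y j - ys))]
    exact Real.sqrt_le_sqrt (h.norm_y_sub_sq_le hP hρ hs j)
  rw [h.residual_eq_inv_smul hρ.ne' k, norm_smul, Real.norm_eq_abs, abs_of_pos (by positivity)]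
  have : ‖y (k + 1) - y k‖ ≤ ‖y (k + 1) - ys‖ + ‖y k - ys‖ := by
    have e : y (k + 1) - y k = (y (k + 1) - ys) - (y k - ys) := by abel
    rw [e]; exact norm_sub_le _ _
  calc 1 / ρ * ‖y (k + 1) - y k‖ ≤ 1 / ρ * (Real.sqrt (ρ * P.lyapunov ρ zs ys z y 0) +
        Real.sqrt (ρ * P.lyapunov ρ zs ys z y 0)) := by
        gcongr
        exact this.trans (add_le_add (hb _) (hb _))
    _ = 2 / ρ * Real.sqrt (ρ * P.lyapunov ρ zs ys z y 0) := by ring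

/-- **OBJECTIVE CONVERGENCE** [BPCPE11, §3.2.1]: `p^k = f(x^k) + g(z^k) → p⋆` ("the righthand
side in (A.2) goes to zero …, because `B(z^{k+1} − z⋆)` is bounded and both `r^{k+1}` and
`B(z^{k+1} − z^k)` go to zero. The righthand side in (A.3) goes to zero …, since `r^k` goes to
zero"). [cite: BoydEtAl2011, §3.2.1] -/
theorem tendsto_objective (h : P.IsADMMSeq ρ x z y) (hP : P.IsConvex) (hρ : 0 < ρ)
    (hs : P.IsSaddlePoint xs zs ys) :
    Tendsto (fun k => P.objective (x k) (z k)) atTop (𝓝 (P.objective xs zs)) := by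
  -- abbreviations for the uniform bounds
  set V0 := P.lyapunov ρ zs ys z y 0 with hV0
  set My := Real.sqrt (ρ * V0) with hMy
  set Me := Real.sqrt (V0 / ρ) with hMe
  set Mr := 2 / ρ * Real.sqrt (ρ * V0) with hMr
  have hMy0 : 0 ≤ My := Real.sqrt_nonneg _
  have hMe0 : 0 ≤ Me := Real.sqrt_nonneg _
  have hMr0 : 0 ≤ Mr := by positivity
  have hyb : ∀ j, ‖y j‖ ≤ ‖ys‖ + My := by
    intro j
    have h1 : ‖y j - ys‖ ≤ My := by
      rw [hMy, ← Real.sqrt_sq (norm_nonneg (y j - ys))]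
      exact Real.sqrt_le_sqrt (h.norm_y_sub_sq_le hP hρ hs j)
    exact (norm_le_insert' (y j) ys).trans (by linarith)
  have heb : ∀ j, ‖P.B (z j - zs)‖ ≤ Me := by
    intro j
    rw [hMe, ← Real.sqrt_sq (norm_nonneg (P.B (z j - zs)))]
    apply Real.sqrt_le_sqrt
    rw [le_div_iff₀ hρ, mul_comm]
    exact h.norm_map_sub_sq_le hP hρ hs j
  have hrb : ∀ j, ‖P.residual (x (j + 1)) (z (j + 1))‖ ≤ Mr := fun j =>
    h.norm_residual_le hP hρ hs j
  -- the two-sided bound `|p^{k+1} − p⋆| ≤ b k`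
  set b : ℕ → ℝ := fun k => (2 * ‖ys‖ + My) * ‖P.residual (x (k + 1)) (z (k + 1))‖ +
    ρ * (Mr + Me) * ‖P.B (z (k + 1) - z k)‖ with hb
  have hbound : ∀ k, |P.objective (x (k + 1)) (z (k + 1)) - P.objective xs zs| ≤ b k := by
    intro k
    have hA2 := h.objective_sub_optimal_le hP hρ.le hs k
    have hA3 := h.optimal_sub_objective_le hs k
    set r := P.residual (x (k + 1)) (z (k + 1)) with hr
    set d := P.B (z (k + 1) - z k) with hd
    set e := P.B (z (k + 1) - zs) with he
    have u1 : -⟪y (k + 1), r⟫ ≤ (‖ys‖ + My) * ‖r‖ := by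
      have h1 := abs_real_inner_le_norm (y (k + 1)) r
      rw [abs_le] at h1
      have h2 : ‖y (k + 1)‖ * ‖r‖ ≤ (‖ys‖ + My) * ‖r‖ :=
        mul_le_mul_of_nonneg_right (hyb _) (norm_nonneg _)
      linarith
    have u2 : -(ρ * ⟪d, -r + e⟫) ≤ ρ * (Mr + Me) * ‖d‖ := by
      have h1 := abs_real_inner_le_norm d (-r + e)
      rw [abs_le] at h1
      have h2 : ‖-r + e‖ ≤ Mr + Me :=
        (norm_add_le _ _).trans (by rw [norm_neg]; exact add_le_add (hrb k) (heb _))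
      have h3 : ‖d‖ * ‖-r + e‖ ≤ ‖d‖ * (Mr + Me) :=
        mul_le_mul_of_nonneg_left h2 (norm_nonneg _)
      have h4 : -⟪d, -r + e⟫ ≤ ‖d‖ * (Mr + Me) := by linarith
      have h5 := mul_le_mul_of_nonneg_left h4 hρ.le
      linarith
    have l1 : ⟪ys, r⟫ ≤ (‖ys‖ + My) * ‖r‖ := by
      have h1 := abs_real_inner_le_norm ys r
      rw [abs_le] at h1
      have : ‖ys‖ * ‖r‖ ≤ (‖ys‖ + My) * ‖r‖ :=
        mul_le_mul_of_nonneg_right (by linarith) (norm_nonneg _)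
      linarith
    have hpos1 : 0 ≤ (‖ys‖ + My) * ‖r‖ := by positivity
    have hpos2 : 0 ≤ ρ * (Mr + Me) * ‖d‖ := by positivity
    have hpos3 : 0 ≤ ‖ys‖ * ‖r‖ := by positivity
    rw [abs_le]
    constructor
    · simp only [hb]; nlinarith
    · simp only [hb]; nlinarith
  have hb0 : Tendsto b atTop (𝓝 0) := by
    have t1 : Tendsto (fun k => ‖P.residual (x (k + 1)) (z (k + 1))‖) atTop (𝓝 0) := by
      have := (tendsto_add_atTop_iff_nat (f := fun k => P.residual (x k) (z k)) 1).mpr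
        (h.tendsto_residual hP hρ hs)
      exact tendsto_zero_iff_norm_tendsto_zero.mp this
    have t2 : Tendsto (fun k => ‖P.B (z (k + 1) - z k)‖) atTop (𝓝 0) :=
      tendsto_zero_iff_norm_tendsto_zero.mp (h.tendsto_map_sub hP hρ hs)
    have := (t1.const_mul (2 * ‖ys‖ + My)).add (t2.const_mul (ρ * (Mr + Me)))
    simpa [hb] using this
  have hsub : Tendsto (fun k => P.objective (x (k + 1)) (z (k + 1)) - P.objective xs zs)
      atTop (𝓝 0) :=
    squeeze_zero_norm (fun k => by rw [Real.norm_eq_abs]; exact hbound k) hb0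
  have h1 : Tendsto (fun k => P.objective (x (k + 1)) (z (k + 1))) atTop
      (𝓝 (P.objective xs zs)) := tendsto_sub_nhds_zero_iff.mp hsub
  exact (tendsto_add_atTop_iff_nat (f := fun k => P.objective (x k) (z k)) 1).mp h1

end IsADMMSeq

end Problem

end Literature.Analysis.Convex.ADMM

end
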